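import Summits.BirchSwinnertonDyer.BirchSwinnertonDyer.Theorems.CyclotomicUntwistAmiceRankOne
import HarnessLib

/-!
# The SIMPLE-zero criterion at `𝟙`: on a rank-one Pollack–Stevens row, `ord_𝟙(𝓛^η_W) = 1` iff the
# derivative datum `c₁ = ∫_Γ ℓ d𝓛 = 𝓛′(0)` is non-zero — what the analytic half of K1/K2 reduces to

Cell `pub/bsd-wall` (D-0145 line `route-BirchSwinnertonDyer-CyclotomicUntwist`), seat `bsd-line-cycu-p1`
(prover seat 1/3), helper toward crux K1 `PSRankOneLowerHalfAtThree` (stmt-BirchSwinnertonDyer-21580; mirror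
K2, 21581), D1/D3 currency; sequel of `CyclotomicUntwistAmiceRankOne`.  THEOREMS ONLY (no definition, no
named fact, no `sorry`); BSD is not proved by this file and no crux is.  The cruxes' analytic input «`𝓛^η_W`
has EXACT order `1` at `𝟙`» (GZ₃-side) is here reduced, unconditionally, to the single non-vanishing
`c₁(𝓛) ≠ 0` of D1's first Mahler coefficient (`gammaMahlerCoeff 3 𝓛 1`, the `T`-derivative at `0`,
`= ∫_Γ ℓ d𝓛` by D1 §Amice) — nothing more and nothing less is asked of GZ₃ on the order side.

* `gammaOrderAtOne_eq_one_iff` (general `p`): `ord_𝟙(μ) = 1 ↔ c₀(μ) = 0 ∧ c₁(μ) ≠ 0`, and then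
  `lead_𝟙(μ) = c₁(μ)` (`gammaLeadingCoeff_eq_coeff_one`).
* `orderAtOne_eq_one_iff_of_entireLFunction_one_eq_zero` — for `W` additive at `3` with `L(W,1) = 0`, `η`
  primitive mod `9`, `α ≠ 0`, `IsPSCyclotomicLFunctionOf W η α 𝓛`:
  **`gammaOrderAtOne 3 𝓛 = 1 ↔ gammaMahlerCoeff 3 𝓛 1 ≠ 0`**; `orderAtOne_eq_one_iff_of_analyticRank_eq_one`
  — the same on the rows of K1/K2; `two_le_orderAtOne_iff_of_analyticRank_eq_one` — otherwise the order is
  `≥ 2` (never `⊤`: `CyclotomicUntwistAmiceRankOne`).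

References: [cite: MazurTateTeitelbaum1986Invent, §I.13 and §I.14]; [cite: Bellaiche2021, Thm. 6.2.13].
-/

noncomputable section

open scoped MatrixGroups

open Filter Topology Literature.NumberTheory.IwasawaTheory
  Literature.NumberTheory.EllipticCurves Literature.NumberTheory.EllipticCurves.Rank1Residual
  Summit.BirchSwinnertonDyer.BirchSwinnertonDyer.Theorems.PSAmiceInjective
  Summit.BirchSwinnertonDyer.BirchSwinnertonDyer.Theorems.CyclotomicUntwistValueAtOne
  Summit.BirchSwinnertonDyer.BirchSwinnertonDyer.Theorems.PSAmiceRankOne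

-- single-conjunct summit: `Summit.BirchSwinnertonDyer.BirchSwinnertonDyer.…` repeats the name by design
set_option linter.dupNamespace false
set_option autoImplicit false

namespace Summit.BirchSwinnertonDyer.BirchSwinnertonDyer.Theorems.PSAmiceOrderOne

variable {p : ℕ} [hp : Fact p.Prime]

/-! ### §1 Order exactly one, for any ball values -/

section General

variable {μ : (n : ℕ) → ZMod (p ^ n) → ℂ_[p]}

/-- **`ord_𝟙(μ) = 1 ↔ c₀ = 0 ∧ c₁ ≠ 0`** (the order of a power series is `1` iff the constant term vanishes
and the linear one does not; Mathlib `PowerSeries.order_eq_nat`). [cite: MazurTateTeitelbaum1986Invent, §I.13] -/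
theorem gammaOrderAtOne_eq_one_iff :
    gammaOrderAtOne p μ = 1 ↔ gammaMahlerCoeff p μ 0 = 0 ∧ gammaMahlerCoeff p μ 1 ≠ 0 := by
  rw [gammaOrderAtOne_def, show (1 : ℕ∞) = ((1 : ℕ) : ℕ∞) from rfl, PowerSeries.order_eq_nat]
  simp only [coeff_gammaAmiceTransform, Nat.lt_one_iff, forall_eq]
  exact and_comm

/-- If `ord_𝟙(μ) = 1` then `lead_𝟙(μ) = c₁(μ)`. [cite: MazurTateTeitelbaum1986Invent, §I.13] -/
theorem gammaLeadingCoeff_eq_coeff_one (h : gammaOrderAtOne p μ = 1) :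
    gammaLeadingCoeff p μ = gammaMahlerCoeff p μ 1 := by
  rw [gammaLeadingCoeff_def, h]
  simp

/-- With `c₀ = 0` and a FINITE order: `ord_𝟙 = 1 ∨ 2 ≤ ord_𝟙`, the first case iff `c₁ ≠ 0`.
[cite: MazurTateTeitelbaum1986Invent, §I.13] -/
theorem two_le_gammaOrderAtOne_iff (h0 : gammaMahlerCoeff p μ 0 = 0) (hlt : gammaOrderAtOne p μ < ⊤) :
    2 ≤ gammaOrderAtOne p μ ↔ gammaMahlerCoeff p μ 1 = 0 := by
  constructor
  · intro h2
    have h : ((1 : ℕ) : ℕ∞) < (gammaAmiceTransform p μ).order := by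
      rw [← gammaOrderAtOne_def]
      exact lt_of_lt_of_le (by exact_mod_cast Nat.one_lt_two) h2
    have := PowerSeries.coeff_of_lt_order 1 h
    rwa [coeff_gammaAmiceTransform] at this
  · intro h1
    obtain ⟨r, hr⟩ := ENat.ne_top_iff_exists.1 (ne_top_of_lt hlt)
    rw [← hr]
    have hr2 : ¬ r < 2 := by
      intro hlt2
      interval_cases r
      · -- `r = 0`: then `c₀ ≠ 0`
        have hne : gammaAmiceTransform p μ ≠ 0 := by
          rw [← PowerSeries.order_finite_iff_ne_zero, ← gammaOrderAtOne_def]; exact hlt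
        have h := PowerSeries.coeff_order hne
        rw [← gammaOrderAtOne_def, ← hr] at h
        simp only [ENat.toNat_coe, coeff_gammaAmiceTransform] at h
        exact h h0
      · -- `r = 1`: then `c₁ ≠ 0`
        have h := (gammaOrderAtOne_eq_one_iff (μ := μ)).1 (by rw [← hr]; rfl)
        exact h.2 h1
    exact_mod_cast (not_lt.1 hr2)

end General

/-! ### §2 Rank-one Pollack–Stevens rows -/

section Curve

variable {W : WeierstrassCurve ℚ} [W.IsElliptic] {η : DirichletCharacter ℂ_[3] (3 ^ 2)} {α : ℂ_[3]}
  {𝓛 : (n : ℕ) → ZMod (3 ^ n) → ℂ_[3]}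

/-- **Simple-zero criterion.** For `W` additive at `3` with `L(W,1) = 0`, `η` primitive mod `9`, `α ≠ 0`,
`IsPSCyclotomicLFunctionOf W η α 𝓛`: `ord_𝟙(𝓛) = 1 ↔ c₁(𝓛) ≠ 0`, and then `lead_𝟙(𝓛) = c₁(𝓛)`
(`c₀ = 𝓛(𝟙) = 0` by `CyclotomicUntwistValueAtOne.vanishing_at_one`). [cite: MazurTateTeitelbaum1986Invent, §I.13 and §I.14] -/
theorem orderAtOne_eq_one_iff_of_entireLFunction_one_eq_zero (h : IsPSCyclotomicLFunctionOf W η α 𝓛)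
    (hadd : Addv W 3) (hη : η.IsPrimitive) (hL : W.entireLFunction 1 = 0) :
    (gammaOrderAtOne 3 𝓛 = 1 ↔ gammaMahlerCoeff 3 𝓛 1 ≠ 0) ∧
      (gammaOrderAtOne 3 𝓛 = 1 → gammaLeadingCoeff 3 𝓛 = gammaMahlerCoeff 3 𝓛 1) := by
  obtain ⟨-, hc0, -, -⟩ := vanishing_at_one η α 𝓛 h hadd hη hL
  refine ⟨?_, gammaLeadingCoeff_eq_coeff_one⟩
  rw [gammaOrderAtOne_eq_one_iff]
  exact ⟨fun h' ↦ h'.2, fun h' ↦ ⟨hc0, h'⟩⟩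

/-- **On the rows of K1/K2 (`W.analyticRank = 1`): `ord_𝟙(𝓛^η_W) = 1 ↔ c₁(𝓛^η_W) ≠ 0`**, with
`lead_𝟙 = c₁` in that case — the analytic half of the cruxes' «exact order one» is exactly the
non-vanishing of D1's derivative datum `∫_Γ ℓ d𝓛`. [cite: MazurTateTeitelbaum1986Invent, §I.13 and §I.14] -/
theorem orderAtOne_eq_one_iff_of_analyticRank_eq_one (h : IsPSCyclotomicLFunctionOf W η α 𝓛)
    (hadd : Addv W 3) (hη : η.IsPrimitive) (hr : W.analyticRank = 1) :
    (gammaOrderAtOne 3 𝓛 = 1 ↔ gammaMahlerCoeff 3 𝓛 1 ≠ 0) ∧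
      (gammaOrderAtOne 3 𝓛 = 1 → gammaLeadingCoeff 3 𝓛 = gammaMahlerCoeff 3 𝓛 1) :=
  orderAtOne_eq_one_iff_of_entireLFunction_one_eq_zero h hadd hη
    (entireLFunction_one_eq_zero_of_analyticRank_eq_one hr)

/-- **… and otherwise the order is at least `2` (never infinite).** For `W` additive at `3` of analytic rank
`1`, `η` primitive mod `9`, `α ≠ 0`: `2 ≤ ord_𝟙(𝓛) ↔ c₁(𝓛) = 0` (finiteness from
`CyclotomicUntwistAmiceInjective`). [cite: MazurTateTeitelbaum1986Invent, §I.13 and §I.14] -/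
theorem two_le_orderAtOne_iff_of_analyticRank_eq_one (h : IsPSCyclotomicLFunctionOf W η α 𝓛)
    (hadd : Addv W 3) (hη : η.IsPrimitive) (hα : α ≠ 0) (hr : W.analyticRank = 1) :
    2 ≤ gammaOrderAtOne 3 𝓛 ↔ gammaMahlerCoeff 3 𝓛 1 = 0 := by
  obtain ⟨-, hc0, -, -⟩ := vanishing_at_one_of_analyticRank_eq_one η α 𝓛 h hadd hη hr
  exact two_le_gammaOrderAtOne_iff hc0 (gammaOrderAtOne_lt_top_of_isPSCyclotomicLFunctionOf h hη hα).1

end Curve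

end Summit.BirchSwinnertonDyer.BirchSwinnertonDyer.Theorems.PSAmiceOrderOne

end
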